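import Summits.ValiantsHypothesis.ValiantsHypothesis.Theorems.KPlusLogSqLawTropicalBToeplitzStringLaw

/-!
# Route `KPlusLogSqLaw`, crux `TropicalB` — Toeplitz sector: THE STRING LAW, Part 2 — rankings are WINDOW-COUNT permutations

HONEST FRAMING.  Helper toward the registered stubs `stub_tropThin` / `stub_tropFat` of `Cruxes/TropicalB/Lines/birth.lean` (crux
`Summit.ValiantsHypothesis.ValiantsHypothesis.Theses.KPlusLogSqLaw.TropicalB`, ledger item `stmt-ValiantsHypothesis-19771`, route `KPlusLogSqLaw`;
cell `pub-symmetroid`, seat `val-sym-trop-p4` (g24), 2026-08-29; `--supports … --as helper`).  Continuation of `…ToeplitzStringLaw` (Part 1: every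
maximiser of the parameter-free pencil `P(σ) = Σ_b (K|σ b − b| − c(σ b − b)²)` is the RANKING `ρ` of the keys `κ_b = 2c b + K ε_b` of its own sign
string `ε`).  Here the rankings are made explicit.  For `0 ≤ K`, `0 < c`, a `±1`-string `ε` and a ranking `ρ` of its keys
(`ρ b < ρ b' ↔ κ_b < κ_{b'}`):
* `ranking_val_eq_card` — `ρ b = #{b' : κ_{b'} < κ_b}` (any keys);
* `ranking_ge_of_pos` / `ranking_le_of_neg` — COMPATIBILITY: `ε_b = 1 ⇒ b ≤ ρ b` and `ε_b = −1 ⇒ ρ b ≤ b`; hence `P(ρ)` equals its own linearisation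
  `Σ_b (K ε_b δ_b − c δ_b²)` (`pencil_ranking_eq_linSum`), i.e. (Part 1, `linSum_eq_keySum`) the key functional minus the string constant;
* ★ `ranking_displacement_of_pos` / `ranking_displacement_of_neg` — WINDOW COUNTS: for `ε_b = 1` the displacement `ρ b − b` is the number of `−1`'s
  at positions `b' > b` with `c (b' − b) < K`; for `ε_b = −1` it is minus the number of `+1`'s at positions `b' < b` with `c (b − b') ≤ K`.  For the
  pencil of record (`c = 2`, `K = 2L + 1`) these are the window counts `n_b = #D ∈ (b, b+L]` resp. `#U ∈ [b−L, b)` of the memo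
  HOME/val-sym-trop-p4/g23/MORPH-THEOREM-g23.md §1, so `P(ρ_ε) = Σ_b n_b (K − 2 n_b)` and the morph member `μ_j` of `morph_member` (`L = 2q + j`) is
  the ranking of the string `U^q D^{q−j} (UD)^j U^{q−j} D^q`.
* ★ `pencil_lt_of_stringOpt` — STRING OPTIMALITY TRANSFERS: if a string `ε⋆` beats every other string at the level of rankings
  (`P(ρ') < P(ρ⋆)`), then `ρ⋆` is the UNIQUE maximiser of the pencil over all of `S_m` — the exact sense in which `morph_member` (both
  parities) is a statement about the `2^m` strings rather than the `m!` permutations.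
Nothing here bounds `Φ_Toep` from above; `ConjectureTPoly`, `TropicalB`, `WeakLifting`, `KPlusLogSqLaw`, `MatrixDescartes` (stmt-ValiantsHypothesis-18050)
and `VP ≠ VNP` are untouched.  [folklore] (counting below a rank).
-/

set_option linter.dupNamespace false
set_option autoImplicit false

namespace Summit.ValiantsHypothesis.ValiantsHypothesis.Theorems.KPlusLogSqLaw.Toeplitz

open scoped BigOperators
open Finset

variable {m : ℕ}

/-! ## 5. Rankings are compatible with their strings; displacements are window counts -/

/-- **`ρ b = #{b' : κ_{b'} < κ_b}`** — the value of a ranking is the number of smaller keys. [folklore] -/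
theorem ranking_val_eq_card (κ : Fin m → ℤ) (ρ : Equiv.Perm (Fin m)) (hρ : ∀ b b', ρ b < ρ b' ↔ κ b < κ b') (b : Fin m) :
    ((ρ b : Fin m) : ℕ) = (Finset.univ.filter fun b' => κ b' < κ b).card := by
  have h1 : (Finset.univ.filter fun b' => κ b' < κ b) = (Finset.univ.filter fun b' : Fin m => ρ b' < ρ b) := by
    ext b'; simp [hρ]
  rw [h1]
  have h2 : (Finset.univ.filter fun b' : Fin m => ρ b' < ρ b) = (Finset.Iio (ρ b)).map ρ.symm.toEmbedding := by
    ext x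
    simp only [Finset.mem_filter, Finset.mem_univ, true_and, Finset.mem_map_equiv, Equiv.symm_symm, Finset.mem_Iio]
  rw [h2, Finset.card_map, Fin.card_Iio]

/-- For `0 < c` and `0 ≤ K`, a position carrying `+1` is ranked at least at its own index: `ε_b = 1 ⇒ b ≤ ρ b` (every `b' < b` has a
smaller key). [folklore] -/
theorem ranking_ge_of_pos (K c : ℤ) (hK : 0 ≤ K) (hc : 0 < c) (ε : Fin m → ℤ) (hε : ∀ b, ε b = 1 ∨ ε b = -1)
    (ρ : Equiv.Perm (Fin m)) (hρ : ∀ b b', ρ b < ρ b' ↔ 2 * c * (b : ℤ) + K * ε b < 2 * c * (b' : ℤ) + K * ε b')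
    (b : Fin m) (hb : ε b = 1) : b ≤ ρ b := by
  have hsub : ∀ b' ∈ Finset.Iio b, ρ b' ∈ Finset.Iio (ρ b) := by
    intro b' hb'
    rw [Finset.mem_Iio] at hb' ⊢
    refine (hρ _ _).mpr ?_
    have h1 : (b' : ℤ) < b := by exact_mod_cast hb'
    have h2 : K * ε b' ≤ K := by rcases hε b' with h | h <;> rw [h] <;> nlinarith
    rw [hb]; nlinarith
  have hcard : (Finset.Iio b).card ≤ (Finset.Iio (ρ b)).card :=
    Finset.card_le_card_of_injOn (fun b' => ρ b') (fun b' hb' => by simpa using hsub b' (by simpa using hb'))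
      ρ.injective.injOn
  rw [Fin.card_Iio, Fin.card_Iio] at hcard
  exact Fin.le_def.mpr hcard

/-- For `0 < c` and `0 ≤ K`, a position carrying `−1` is ranked at most at its own index: `ε_b = −1 ⇒ ρ b ≤ b`. [folklore] -/
theorem ranking_le_of_neg (K c : ℤ) (hK : 0 ≤ K) (hc : 0 < c) (ε : Fin m → ℤ) (hε : ∀ b, ε b = 1 ∨ ε b = -1)
    (ρ : Equiv.Perm (Fin m)) (hρ : ∀ b b', ρ b < ρ b' ↔ 2 * c * (b : ℤ) + K * ε b < 2 * c * (b' : ℤ) + K * ε b')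
    (b : Fin m) (hb : ε b = -1) : ρ b ≤ b := by
  have hsub : ∀ b' ∈ Finset.Ioi b, ρ b' ∈ Finset.Ioi (ρ b) := by
    intro b' hb'
    rw [Finset.mem_Ioi] at hb' ⊢
    refine (hρ _ _).mpr ?_
    have h1 : (b : ℤ) < b' := by exact_mod_cast hb'
    have h2 : -K ≤ K * ε b' := by rcases hε b' with h | h <;> rw [h] <;> nlinarith
    rw [hb]; nlinarith
  have hcard : (Finset.Ioi b).card ≤ (Finset.Ioi (ρ b)).card :=
    Finset.card_le_card_of_injOn (fun b' => ρ b') (fun b' hb' => by simpa using hsub b' (by simpa using hb'))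
      ρ.injective.injOn
  rw [Fin.card_Ioi, Fin.card_Ioi] at hcard
  have := b.isLt; have := (ρ b).isLt
  exact Fin.le_def.mpr (by omega)

/-- Hence a ranking is COMPATIBLE with its own string (`ε_b (ρ b − b) = |ρ b − b|`), and its pencil value equals its linearisation /
key functional: `P(ρ_ε) = Σ_b (K ε_b δ_b − c δ_b²)`. [folklore] -/
theorem pencil_ranking_eq_linSum (K c : ℤ) (hK : 0 ≤ K) (hc : 0 < c) (ε : Fin m → ℤ) (hε : ∀ b, ε b = 1 ∨ ε b = -1)
    (ρ : Equiv.Perm (Fin m)) (hρ : ∀ b b', ρ b < ρ b' ↔ 2 * c * (b : ℤ) + K * ε b < 2 * c * (b' : ℤ) + K * ε b') :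
    ∑ b, (K * |((ρ b : Fin m) : ℤ) - b| - c * (((ρ b : Fin m) : ℤ) - b) ^ 2) =
      ∑ b, (K * ε b * (((ρ b : Fin m) : ℤ) - b) - c * (((ρ b : Fin m) : ℤ) - b) ^ 2) := by
  refine (linSum_eq_pencil_of_compatible K c ε ρ fun b => ?_).symm
  rcases hε b with h | h
  · have := ranking_ge_of_pos K c hK hc ε hε ρ hρ b h
    have h' : (b : ℤ) ≤ ((ρ b : Fin m) : ℤ) := by exact_mod_cast this
    rw [h, one_mul, abs_of_nonneg (by linarith)]
  · have := ranking_le_of_neg K c hK hc ε hε ρ hρ b h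
    have h' : ((ρ b : Fin m) : ℤ) ≤ (b : ℤ) := by exact_mod_cast this
    rw [h, abs_of_nonpos (by linarith)]; ring

/-- **WINDOW COUNT, `+1` positions**: for `0 ≤ K`, `0 < c`, if `ε_b = 1` then the displacement of the ranking at `b` is the number of `−1`'s
at positions `b' > b` with `c (b' − b) < K` (for `c = 2`, `K = 2L+1`: the `D`'s in the window `(b, b + L]`). [folklore] -/
theorem ranking_displacement_of_pos (K c : ℤ) (hK : 0 ≤ K) (hc : 0 < c) (ε : Fin m → ℤ) (hε : ∀ b, ε b = 1 ∨ ε b = -1)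
    (ρ : Equiv.Perm (Fin m)) (hρ : ∀ b b', ρ b < ρ b' ↔ 2 * c * (b : ℤ) + K * ε b < 2 * c * (b' : ℤ) + K * ε b')
    (b : Fin m) (hb : ε b = 1) :
    ((ρ b : Fin m) : ℤ) - b =
      ((Finset.univ.filter fun b' : Fin m => b < b' ∧ ε b' = -1 ∧ c * ((b' : ℤ) - b) < K).card : ℤ) := by
  have hval := ranking_val_eq_card (fun b => 2 * c * (b : ℤ) + K * ε b) ρ hρ b
  -- split the smaller keys into `b' < b` (all of them) and `b' > b` with `ε = −1`, `c(b'−b) < K`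
  have hsplit : (Finset.univ.filter fun b' : Fin m => 2 * c * (b' : ℤ) + K * ε b' < 2 * c * (b : ℤ) + K * ε b) =
      Finset.Iio b ∪ (Finset.univ.filter fun b' : Fin m => b < b' ∧ ε b' = -1 ∧ c * ((b' : ℤ) - b) < K) := by
    ext b'
    simp only [Finset.mem_filter, Finset.mem_univ, true_and, Finset.mem_union, Finset.mem_Iio]
    rw [hb]
    constructor
    · intro h
      rcases lt_trichotomy b' b with hlt | heq | hgt
      · exact Or.inl hlt
      · subst heq; rw [hb] at h; exact absurd h (lt_irrefl _)
      · right
        refine ⟨hgt, ?_, ?_⟩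
        · rcases hε b' with h' | h'
          · exfalso; rw [h'] at h
            have : (b : ℤ) < b' := by exact_mod_cast hgt
            nlinarith
          · exact h'
        · rcases hε b' with h' | h' <;> rw [h'] at h <;> nlinarith
    · rintro (hlt | ⟨hgt, hε', hlt⟩)
      · have h1 : (b' : ℤ) < b := by exact_mod_cast hlt
        have h2 : K * ε b' ≤ K := by rcases hε b' with h | h <;> rw [h] <;> nlinarith
        nlinarith
      · rw [hε']; nlinarith
  have hdisj : Disjoint (Finset.Iio b)
      (Finset.univ.filter fun b' : Fin m => b < b' ∧ ε b' = -1 ∧ c * ((b' : ℤ) - b) < K) := by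
    rw [Finset.disjoint_left]
    intro b' h1 h2
    rw [Finset.mem_Iio] at h1
    simp only [Finset.mem_filter, Finset.mem_univ, true_and] at h2
    exact absurd (h1.trans h2.1) (lt_irrefl _)
  rw [hsplit, Finset.card_union_of_disjoint hdisj, Fin.card_Iio] at hval
  have : (((ρ b : Fin m) : ℕ) : ℤ) = (b : ℕ) +
      ((Finset.univ.filter fun b' : Fin m => b < b' ∧ ε b' = -1 ∧ c * ((b' : ℤ) - b) < K).card : ℤ) := by
    exact_mod_cast hval
  linarith

/-- **WINDOW COUNT, `−1` positions**: for `0 ≤ K`, `0 < c`, if `ε_b = −1` then the displacement of the ranking at `b` is MINUS the number of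
`+1`'s at positions `b' < b` with `c (b − b') ≤ K` (for `c = 2`, `K = 2L+1`: the `U`'s in the window `[b − L, b)`). [folklore] -/
theorem ranking_displacement_of_neg (K c : ℤ) (hK : 0 ≤ K) (hc : 0 < c) (ε : Fin m → ℤ) (hε : ∀ b, ε b = 1 ∨ ε b = -1)
    (ρ : Equiv.Perm (Fin m)) (hρ : ∀ b b', ρ b < ρ b' ↔ 2 * c * (b : ℤ) + K * ε b < 2 * c * (b' : ℤ) + K * ε b')
    (b : Fin m) (hb : ε b = -1) :
    ((ρ b : Fin m) : ℤ) - b =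
      -((Finset.univ.filter fun b' : Fin m => b' < b ∧ ε b' = 1 ∧ c * ((b : ℤ) - b') ≤ K).card : ℤ) := by
  have hval := ranking_val_eq_card (fun b => 2 * c * (b : ℤ) + K * ε b) ρ hρ b
  -- the smaller keys are exactly the `b' < b` NOT in the window set
  have hsplit : (Finset.univ.filter fun b' : Fin m => 2 * c * (b' : ℤ) + K * ε b' < 2 * c * (b : ℤ) + K * ε b) =
      Finset.Iio b \ (Finset.univ.filter fun b' : Fin m => b' < b ∧ ε b' = 1 ∧ c * ((b : ℤ) - b') ≤ K) := by
    ext b'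
    simp only [Finset.mem_filter, Finset.mem_univ, true_and, Finset.mem_sdiff, Finset.mem_Iio, not_and, not_le]
    rw [hb]
    constructor
    · intro h
      have hlt : b' < b := by
        by_contra hge
        push Not at hge
        have h1 : (b : ℤ) ≤ b' := by exact_mod_cast hge
        have h2 : -K ≤ K * ε b' := by rcases hε b' with h' | h' <;> rw [h'] <;> nlinarith
        nlinarith
      refine ⟨hlt, fun _ h1 => ?_⟩
      rw [h1] at h; nlinarith
    · rintro ⟨hlt, himp⟩
      have h1 : (b' : ℤ) < b := by exact_mod_cast hlt
      rcases hε b' with h' | h'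
      · have := himp hlt h'
        rw [h']; nlinarith
      · rw [h']; nlinarith
  have hsub : (Finset.univ.filter fun b' : Fin m => b' < b ∧ ε b' = 1 ∧ c * ((b : ℤ) - b') ≤ K) ⊆ Finset.Iio b := by
    intro b' h
    simp only [Finset.mem_filter, Finset.mem_univ, true_and] at h
    exact Finset.mem_Iio.mpr h.1
  rw [hsplit, Finset.card_sdiff_of_subset hsub, Fin.card_Iio] at hval
  have hle := Finset.card_le_card hsub
  rw [Fin.card_Iio] at hle
  have : (((ρ b : Fin m) : ℕ) : ℤ) = ((b : ℕ) : ℤ) -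
      ((Finset.univ.filter fun b' : Fin m => b' < b ∧ ε b' = 1 ∧ c * ((b : ℤ) - b') ≤ K).card : ℤ) := by
    rw [hval]; push_cast [Nat.cast_sub hle]; ring
  linarith


/-! ## String optimality transfers to the pencil -/

/-- ★ **STRING OPTIMALITY TRANSFERS.**  Let `0 ≤ K`, `0 < c`, `c·t ≠ K` for `0 < t < m` (so every string has a unique ranking).  If a string
`ε⋆` beats every other string at the level of rankings — `P(ρ') < P(ρ⋆)` whenever `ρ'` ranks a `±1`-string `ε' ≠ ε⋆` and `ρ⋆` ranks `ε⋆` — then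
its ranking `ρ⋆` is the UNIQUE maximiser of the pencil over all of `S_m`: `P(σ) < P(ρ⋆)` for every `σ ≠ ρ⋆`.  (By the string law `P(σ) ≤ P(ρ)`
for the ranking `ρ` of `σ`'s own string `ε`; if `ε ≠ ε⋆` conclude by hypothesis, if `ε = ε⋆` then `ρ = ρ⋆` by uniqueness of rankings and the
string law is strict.)  This is the exact sense in which the morph theorem `morph_member` (both parities) is a statement about `2^m` strings.
[folklore] -/
theorem pencil_lt_of_stringOpt (K c : ℤ) (hK : 0 ≤ K) (hc : 0 < c) (hKc : ∀ t : ℤ, 0 < t → t < m → c * t ≠ K)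
    (εs : Fin m → ℤ) (ρs : Equiv.Perm (Fin m))
    (hρs : ∀ b b', ρs b < ρs b' ↔ 2 * c * (b : ℤ) + K * εs b < 2 * c * (b' : ℤ) + K * εs b')
    (hopt : ∀ (ε' : Fin m → ℤ) (ρ' : Equiv.Perm (Fin m)), (∀ b, ε' b = 1 ∨ ε' b = -1) → ε' ≠ εs →
      (∀ b b', ρ' b < ρ' b' ↔ 2 * c * (b : ℤ) + K * ε' b < 2 * c * (b' : ℤ) + K * ε' b') →
      ∑ b, (K * |((ρ' b : Fin m) : ℤ) - b| - c * (((ρ' b : Fin m) : ℤ) - b) ^ 2) <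
        ∑ b, (K * |((ρs b : Fin m) : ℤ) - b| - c * (((ρs b : Fin m) : ℤ) - b) ^ 2))
    (σ : Equiv.Perm (Fin m)) (hσ : σ ≠ ρs) :
    ∑ b, (K * |((σ b : Fin m) : ℤ) - b| - c * (((σ b : Fin m) : ℤ) - b) ^ 2) <
      ∑ b, (K * |((ρs b : Fin m) : ℤ) - b| - c * (((ρs b : Fin m) : ℤ) - b) ^ 2) := by
  obtain ⟨ρ, hρ⟩ := exists_selfRanking K c hK hc hKc σ
  set ε : Fin m → ℤ := fun b => if (b : ℤ) ≤ ((σ b : Fin m) : ℤ) then (1 : ℤ) else -1 with hεdef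
  have hε : ∀ b, ε b = 1 ∨ ε b = -1 := fun b => signString_mem σ b
  by_cases heq : ε = εs
  · -- same string: `ρ = ρs` by uniqueness of rankings, and the string law is strict for `σ ≠ ρ`
    have hρ' : ∀ b b', ρ b < ρ b' ↔ 2 * c * (b : ℤ) + K * εs b < 2 * c * (b' : ℤ) + K * εs b' := by
      intro b b'; rw [← heq]; exact hρ b b'
    have hρρ : ρ = ρs := ranking_unique (fun b => 2 * c * (b : ℤ) + K * εs b) hρ' hρs
    rw [← hρρ]
    exact pencil_lt_pencil_selfRanking K c hK σ ρ hρ (hρρ ▸ hσ)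
  · exact lt_of_le_of_lt (pencil_le_pencil_selfRanking K c hK σ ρ hρ) (hopt ε ρ hε heq hρ)

end Summit.ValiantsHypothesis.ValiantsHypothesis.Theorems.KPlusLogSqLaw.Toeplitz
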